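import Literature.AlgebraicGeometry.Modules.SerreTwistCharts
import Literature.AlgebraicGeometry.Morphisms.CechH1ProjectiveFinite
import Literature.AlgebraicGeometry.Motives.ChernClassesProofs
import HarnessLib

/-!
# Serre's twisting sheaves `𝒪_Z(-m)`: the trivialisations `𝒪_{Z_j} ≅ 𝒪_Z(-m)|_{Z_j}` and local freeness

Continuation of `Modules/SerreTwist`, `Modules/SerreTwistCharts`. For `ι : Z ⟶ 𝐏ʳ_A` and the charts
`Z_j = ι⁻¹ D₊(x_j)`:

* `chartLinearEquiv ι hV : Γ(V, 𝒪_Z(-m)) ≃ₗ[Γ(V, 𝒪_Z)] Γ(V, 𝒪_Z)` for `V ⊆ Z_j` — `f ↦ f_{j⋯j}`, inverse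
  `c ↦ c · v_j|_V` (`SerreTwist.eq_smul_gen`), natural in `V`;
* `overIsoUnit ι m j : 𝒪_Z(-m)|_{Z_j} ≅ 𝒪_{Z_j}` as sheaves of modules over the site of opens of `Z_j`
  (Mathlib `SheafOfModules.over`, `PresheafOfModules.isoMk`), hence `freeIsoOver ι m j :
  SheafOfModules.free PUnit ≅ (serreTwist ι m).over (Zop ι {j})`;
* `isFiniteLocallyFree_serreTwist`, `isVectorBundle_serreTwist` — `𝒪_Z(-m)` is a line bundle (the
  charts cover `Z`, `ProjCech.iSup_cover_eq_top`);
* `serreTwistZeroIso ι : serreTwist ι 0 ≅ 𝒪_Z` (the empty word).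

References: Hartshorne II Prop. 5.12 (b) (`𝒪(n)` is invertible); EGA II 2.5.7.
-/

noncomputable section

universe u

open CategoryTheory AlgebraicGeometry TopologicalSpace Opposite
open Literature.Algebra.Homology Literature.Algebra.Homology.LaurentCech
open Literature.AlgebraicGeometry.Morphisms Literature.AlgebraicGeometry.Morphisms.ProjCech
open Literature.AlgebraicGeometry.Motives

attribute [local instance] MvPolynomial.gradedAlgebra
  Literature.AlgebraicGeometry.Motives.ProjBaseChange.algebraBase

namespace Literature.AlgebraicGeometry.Modules

namespace SerreTwist

variable {A : Type u} [CommRing A] {r : ℕ} {Z : Scheme.{u}} (ι : Z ⟶ PP A r)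

/-! ## The chart coordinate as a linear equivalence -/

/-- **The trivialisation of `𝒪_Z(-m)` on `V ⊆ Z_j`, section-level**: `f ↦ f_{j⋯j}` is a `Γ(V, 𝒪_Z)`-linear
bijection `Γ(V, 𝒪_Z(-m)) ≃ Γ(V, 𝒪_Z)` with inverse `c ↦ c · v_j|_V`. [folklore] -/
def chartLinearEquiv {m : ℕ} {j : Fin (r + 1)} {V : Z.Opens} (hV : V ≤ Zop ι {j}) :
    Γ(serreTwist ι m, V) ≃ₗ[Γ(Z, V)] Γ(Z, V) where
  toFun f := coeff ι f (fun _ => j)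
  invFun c := c • (serreTwist ι m).presheaf.map (homOfLE hV).op (gen ι m j)
  map_add' f g := coeff_add ι f g _
  map_smul' a f := coeff_smul ι a f _
  left_inv f := (eq_smul_gen ι hV f).symm
  right_inv c := coeff_smul_map_gen_const ι hV c

/-- `chartLinearEquiv` is the `j⋯j`-coefficient. [folklore] -/
@[simp]
theorem chartLinearEquiv_apply {m : ℕ} {j : Fin (r + 1)} {V : Z.Opens} (hV : V ≤ Zop ι {j})
    (f : Γ(serreTwist ι m, V)) : chartLinearEquiv ι hV f = coeff ι f (fun _ => j) := rfl

/-- The inverse of `chartLinearEquiv` is `c ↦ c · v_j|_V`. [folklore] -/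
@[simp]
theorem chartLinearEquiv_symm_apply {m : ℕ} {j : Fin (r + 1)} {V : Z.Opens} (hV : V ≤ Zop ι {j})
    (c : Γ(Z, V)) : (chartLinearEquiv ι (m := m) hV).symm c =
      c • (serreTwist ι m).presheaf.map (homOfLE hV).op (gen ι m j) := rfl

/-- Naturality of the chart coordinate under restriction. [folklore] -/
theorem chartLinearEquiv_map {m : ℕ} {j : Fin (r + 1)} {V V' : Z.Opens} (hV : V ≤ Zop ι {j})
    (h : V' ≤ V) (f : Γ(serreTwist ι m, V)) :
    chartLinearEquiv ι (h.trans hV) ((serreTwist ι m).presheaf.map (homOfLE h).op f) =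
      Z.presheaf.map (homOfLE h).op (chartLinearEquiv ι hV f) := rfl

/-! ## The trivialisation over the site of `Z_j` -/

/-- **`𝒪_Z(-m)|_{Z_j} ≅ 𝒪_{Z_j}`** as presheaves of modules over the opens of `Z_j` (objectwise
`chartLinearEquiv`; Mathlib `PresheafOfModules.isoMk`). [folklore] -/
def overValIsoUnit (m : ℕ) (j : Fin (r + 1)) :
    ((serreTwist ι m).over (Zop ι {j})).val ≅ (SheafOfModules.unit (Z.ringCatSheaf.over (Zop ι {j}))).val :=
  PresheafOfModules.isoMk
    (fun Y => (chartLinearEquiv ι (m := m) (j := j) (V := Y.unop.left) Y.unop.hom.le).toModuleIso)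
    (fun Y Y' g => by
      ext f
      exact chartLinearEquiv_map ι Y.unop.hom.le g.unop.left.le f)

/-- **`𝒪_Z(-m)|_{Z_j} ≅ 𝒪_{Z_j}`** as sheaves of modules over the opens of `Z_j`. [folklore] -/
def overIsoUnit (m : ℕ) (j : Fin (r + 1)) :
    (serreTwist ι m).over (Zop ι {j}) ≅ SheafOfModules.unit (Z.ringCatSheaf.over (Zop ι {j})) :=
  (SheafOfModules.fullyFaithfulForget _).preimageIso (overValIsoUnit ι m j)

/-- **The trivialisation `𝒪_{Z_j} ≅ 𝒪_Z(-m)|_{Z_j}`** in the form consumed by `Motives.IsFiniteLocallyFree`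
(`SheafOfModules.free PUnit`, Mathlib `coproductUniqueIso`). [folklore] -/
def freeIsoOver (m : ℕ) (j : Fin (r + 1)) :
    SheafOfModules.free (R := Z.ringCatSheaf.over (Zop ι {j})) PUnit.{u + 1} ≅
      (serreTwist ι m).over (Zop ι {j}) :=
  Limits.coproductUniqueIso (fun _ : PUnit.{u + 1} => SheafOfModules.unit (Z.ringCatSheaf.over (Zop ι {j}))) ≪≫
    (overIsoUnit ι m j).symm

/-- **`𝒪_Z(-m)` is finite locally free (of rank one)**: the charts `Z_j` cover `Z`. [folklore] -/
theorem isFiniteLocallyFree_serreTwist (m : ℕ) : IsFiniteLocallyFree (serreTwist ι m) := by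
  intro x
  have hx : x ∈ (⊤ : Z.Opens) := trivial
  rw [← iSup_cover_eq_top ι] at hx
  obtain ⟨j, hj⟩ := Opens.mem_iSup.mp hx
  exact ⟨Zop ι {j}, hj, PUnit, inferInstance, ⟨freeIsoOver ι m j⟩⟩

/-- `𝒪_Z(-m)` is a vector bundle (Mathlib: locally free of finite type). [folklore] -/
theorem isVectorBundle_serreTwist (m : ℕ) : IsVectorBundle (serreTwist ι m) :=
  (isFiniteLocallyFree_serreTwist ι m).isVectorBundle

/-! ## `𝒪_Z(0) ≅ 𝒪_Z` -/

/-- Every family of length-`0` words is a twist section (there is only the empty word). [folklore] -/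
theorem isTwistSection_zero (U : Z.Opens) (f : (Fin 0 → Fin (r + 1)) → Γ(Z, U)) : IsTwistSection ι 0 U f := by
  intro j w w' V hV hj
  rw [Subsingleton.elim w w']

/-- **`Γ(U, 𝒪_Z(0)) ≃ Γ(U, 𝒪_Z)`**: the coefficient of the empty word. [folklore] -/
def zeroLinearEquiv (U : Z.Opens) : Γ(serreTwist ι 0, U) ≃ₗ[Γ(Z, U)] Γ(Z, U) where
  toFun f := coeff ι f default
  invFun c := mkSection ι (fun _ => c) (isTwistSection_zero ι U _)
  map_add' f g := coeff_add ι f g _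
  map_smul' a f := coeff_smul ι a f _
  left_inv f := SerreTwist.ext ι fun w => by rw [coeff_mkSection, Subsingleton.elim w default]
  right_inv _ := rfl

/-- **`𝒪_Z(0) ≅ 𝒪_Z`** as sheaves of modules (objectwise `zeroLinearEquiv`). [folklore] -/
def serreTwistZeroIso : serreTwist ι 0 ≅ (SheafOfModules.unit Z.ringCatSheaf : Z.Modules) :=
  (SheafOfModules.fullyFaithfulForget _).preimageIso
    (PresheafOfModules.isoMk (fun U => (zeroLinearEquiv ι U.unop).toModuleIso) (fun U V g => by
      ext f
      rfl))

/-- The components of `serreTwistZeroIso`: the empty-word coefficient. [folklore] -/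
theorem serreTwistZeroIso_hom_app_apply (U : Z.Opens) (f : Γ(serreTwist ι 0, U)) :
    (serreTwistZeroIso ι).hom.app U f = coeff ι f default := rfl

end SerreTwist

end Literature.AlgebraicGeometry.Modules

end
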